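import Literature.MathematicalPhysics.QuantumFieldTheory.Balaban1983to89.B6Eq2112Assembly
import Literature.MathematicalPhysics.QuantumFieldTheory.Balaban1983to89.B6Eq226CovarianceMoments

/-!
# `Balaban1983to89.B6Eq2112Lebesgue` — T. Bałaban, *Propagators and renormalization transformations for lattice gauge
# theories. II*, Commun. Math. Phys. **96** (1984) 223–250 [Balaban1984PropagatorsII], Sect. C (2.95) ⇒ (2.112) ⇒ (2.129)
# pp. 240–246: the ANALYTIC hypotheses of `…B6Eq2112Assembly.eq2129_of_295` (convergence of the Gaussian integrals,
# non-vanishing normalisations, the remark on `δ(Q′λ)`) DISCHARGED in the Lebesgue model from the printed positivity statements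

statement-level skeleton of published theorems with citation tags; proofs where landed; nothing here is a claim about the Yang–Mills mass gap

PDF held: `paper:balaban1984-cmp96-propagators-rt-ii` (journal page = PDF page + 222); pp. 225–226, 240–246 read AS IMAGES on the
×2 renders `run/shared/lean/pub/pub-balaban/b2b-balaban-ref1/pages/1984-cmp96-propagators-rt-II/` (2026-08-21).
CITATION HEADER (lean-in-tree rule).  WHAT IS REPRODUCED: lit-balaban SKELETON rows **B6.Eq2.112 / B6.Eq2.129** — the companion
`…B6Eq2112Assembly` (this seat, p253208) derives (2.112) and (2.129) from (2.95) under displayed ANALYTIC hypotheses: absolute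
convergence of the (2.95) and (2.112) integrands (`hint₁`, `hint₂`), `Z, Z′, Z′_j, Z_C ≠ 0`, and the remark *"∫dω′↾_Λδ(Q′₁ω′)
δ(Q′_jλ′ − ω′) = δ(Q′λ′)"* with a constant (`hX`).  Here those hypotheses are PROVED in the full Lebesgue model — `N(Q′_j) =
ker Q′_j`, the admissible `ω`'s = a subspace `S₁` of the unit-lattice functions, `N(Q′) = {λ : Q′_jλ ∈ S₁}`
(`…B6Eq2106` §§1, 4), all carrying additive Haar (Lebesgue) measures — from the POSITIVITY statements the paper prints:
*"One of our main results will be that the operator Δ_a is bounded from below by a positive constant"* (p. 226), (2.11)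
*"the Laplace operator Δ is … invertible on this subspace"* (coercivity of `‖Δλ‖²` on `N(Q′)`), (2.110) *"γ₀‖ω‖² ≦ ⟨ω,Δ′_jω⟩ ≦
γ₁‖ω‖² for ω : Q′₁ω = 0"*, and positivity of the (2.112)/(2.120) form on the gauge-fixed configurations (p. 244 *"It is a
Gaussian integral defined by the quadratic form (2.120)"*, p. 246 *"the forms are bounded from below by γ₀″‖B‖²"*).  PHASE-2 seat
p22 (gen 7); owner r03, referee ref-4.  IMPORTS, restating nothing: `…B6Eq2112Assembly` (this seat), `…B6Eq226CovarianceMoments`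
(gen 6: `gaussian_integrable_pos` — Gaussians of coercive forms on a subspace converge and are positive; through it
`…B6Eq230GaussianRoute.Z_pos`, `…B6Eq232GaussianMoment.integrable_gauss_shift`), `…B6Eq2106` §4 (r03: `decompEquiv`,
`iterated_eq_smul_addHaar` — the remark on `δ(Q′λ)` as Haar uniqueness).

CONTENTS (theorems only; 0 defs; standard axioms).  §1 (private `quad_bound`: `bt − ½γt² ≤ b²/γ − ¼γt²`) **`integrable_exp_of_le`**
(`e^{f}` is Lebesgue-integrable on a finite-dimensional space when `f ≤ c − γ‖·‖²`, `γ > 0`, `f` continuous).  §2 the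
discharges, in the letters of `…B6Eq2112Assembly`: `mem_comap_hP` (`λ₀ = H′_jω ∈ N(Q′)`, the hypothesis `hκ`), **`hX_lebesgue`**
(the remark on `δ(Q′λ)`: `∫_{N(Q′)} F dλ = c⁻¹∫dω↾δ(Q′₁ω)∫dλ′δ(Q′_jλ′)F(λ′ + H′_jω)` for the Gaussian `F = e^{−½‖∂*A−Δλ‖²}`, `c`
the Haar scalar factor of `…B6Eq2106.iterated_eq_smul_addHaar`, by Fubini — convergence from the coercivity (2.11)),
`Zprime_ne_zero`, `ZprimeJ_ne_zero` ((2.11)), `ZC_ne_zero` ((2.110)), `quad_eq_deltaA` + `Z_ne_zero_and_integrable` (p. 226: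
`Δ_a ≥ γ_a > 0` ⇒ `Z ≠ 0` and the (2.95) integrand converges for every source), `integrable_2112` (positivity of the (2.112)
form on the gauge-fixed configurations).  §3 **`eq2129_lebesgue`** —
(2.129) from (2.95) with ONLY structural data and the four printed positivity constants as hypotheses.
HONEST SCOPE: finite-dimensional Lebesgue model; the four positivity statements are hypotheses here (their own rows: B6.Eq2.11,
B6.Eq2.108–2.110, B6.Txt@246, and [4]/[this paper]'s main theorem on `Δ_a`); value = the analytic bookkeeping of Sect. C is
now hypothesis-free beyond print's positivity claims; NOT summit progress.  Unit `lit-balaban-p22` (gen 7), 2026-08-21.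
-/

noncomputable section

open MeasureTheory
open scoped InnerProductSpace

namespace Literature.MathematicalPhysics.QuantumFieldTheory.Balaban1983to89.B6Eq2112Lebesgue

/-! ## §1  Gaussian integrability from a coercive bound -/

section Gauss

variable {E : Type*} [NormedAddCommGroup E] [InnerProductSpace ℝ E] [FiniteDimensional ℝ E] [MeasurableSpace E]
  [BorelSpace E]

omit [InnerProductSpace ℝ E] [FiniteDimensional ℝ E] [MeasurableSpace E] [BorelSpace E] in
/-- `bt − ½γt² ≤ b²/γ − ¼γt²` (`γ > 0`): a linear source costs at most half of a coercive quadratic form. [folklore] -/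
private theorem quad_bound {γ : ℝ} (hγ : 0 < γ) (b t : ℝ) : b * t - γ / 2 * t ^ 2 ≤ b ^ 2 / γ - γ / 4 * t ^ 2 := by
  have key : b ^ 2 / γ - γ / 4 * t ^ 2 - (b * t - γ / 2 * t ^ 2) = (b - γ / 2 * t) ^ 2 / γ := by
    field_simp
    ring
  have h0 : 0 ≤ (b - γ / 2 * t) ^ 2 / γ := div_nonneg (sq_nonneg _) hγ.le
  linarith

/-- **A Gaussian-dominated integrand converges**: on a finite-dimensional real inner-product space with an additive Haar
(Lebesgue) measure, `e^{f}` is integrable whenever `f` is continuous and `f ≤ c − γ‖·‖²` with `γ > 0` (domination by the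
Gaussian `e^{−γ‖·‖²}`, integrable by `…B6Eq230GaussianRoute.Z_pos`) — the convergence of the Gaussian integrals of Sect. C
("a covariance of the last Gaussian integrals", p. 242). [cite: Balaban1984PropagatorsII, (2.106)–(2.110) p.242] -/
theorem integrable_exp_of_le (μ : Measure E) [μ.IsAddHaarMeasure] (f : E → ℝ) (hf : Continuous f) {γ : ℝ} (hγ : 0 < γ)
    (c : ℝ) (hle : ∀ k, f k ≤ c - γ * ‖k‖ ^ 2) : Integrable (fun k => Real.exp (f k)) μ := by
  have hpos : ∀ v : E, (2 * γ) * ‖v‖ ^ 2 ≤ ⟪v, ((2 * γ) • (LinearMap.id : E →ₗ[ℝ] E)) v⟫_ℝ := fun v => by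
    rw [LinearMap.smul_apply, LinearMap.id_apply, real_inner_smul_right, real_inner_self_eq_norm_sq]
  have hG := (B6Eq230GaussianRoute.Z_pos μ ((2 * γ) • (LinearMap.id : E →ₗ[ℝ] E)) (by linarith) hpos).1
  have hG' : Integrable (fun v : E => Real.exp c * Real.exp (-γ * ‖v‖ ^ 2)) μ := by
    refine (hG.const_mul (Real.exp c)).congr (ae_of_all _ fun v => ?_)
    simp only [LinearMap.smul_apply, LinearMap.id_apply, real_inner_smul_right, real_inner_self_eq_norm_sq]
    congr 2
    ring
  refine hG'.mono' hf.rexp.aestronglyMeasurable (ae_of_all _ fun k => ?_)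
  rw [Real.norm_eq_abs, abs_of_pos (Real.exp_pos _), ← Real.exp_add]
  exact Real.exp_le_exp.mpr (by linarith [hle k])

end Gauss

/-! ## §2  The Lebesgue model: the analytic hypotheses of `…B6Eq2112Assembly` discharged from positivity -/

section Lebesgue

variable {A B W T Bs V S NB N : Type*}
  [NormedAddCommGroup A] [InnerProductSpace ℝ A] [FiniteDimensional ℝ A] [MeasurableSpace A] [BorelSpace A]
  [NormedAddCommGroup B] [InnerProductSpace ℝ B] [FiniteDimensional ℝ B] [MeasurableSpace B] [BorelSpace B]
  [NormedAddCommGroup W] [InnerProductSpace ℝ W] [FiniteDimensional ℝ W] [MeasurableSpace W] [BorelSpace W]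
  [NormedAddCommGroup T] [InnerProductSpace ℝ T] [NormedAddCommGroup Bs] [InnerProductSpace ℝ Bs]
  [NormedAddCommGroup V] [InnerProductSpace ℝ V]
  [NormedAddCommGroup S] [InnerProductSpace ℝ S] [FiniteDimensional ℝ S] [MeasurableSpace S] [BorelSpace S]
  [NormedAddCommGroup NB] [NormedSpace ℝ NB] [FiniteDimensional ℝ NB] [MeasurableSpace NB] [BorelSpace NB]
  [NormedAddCommGroup N] [NormedSpace ℝ N] [FiniteDimensional ℝ N] [MeasurableSpace N] [BorelSpace N]

omit [FiniteDimensional ℝ B] [MeasurableSpace B] [BorelSpace B] [FiniteDimensional ℝ W] [MeasurableSpace W]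
  [BorelSpace W] in
/-- `λ₀ = H′_jω ∈ N(Q′)` for admissible `ω` (*"Q′_jλ₀ = Q′_jH′_jω = ω = 0 on Λ^c, and Q′_{j+1}λ₀ = Q′₁ω = 0 on Λ′"*): with
`N(Q′) = {λ : Q′_jλ ∈ S₁}` (`…B6Eq2106` §1) this is `Q′_jH′_j = I` — the hypothesis `hκ` of `…B6Eq2112`.
[cite: Balaban1984PropagatorsII, (2.105) p.241] -/
theorem mem_comap_hP (Qp : B →ₗ[ℝ] W) (hP : W →ₗ[ℝ] B) (hQpH : Qp ∘ₗ hP = LinearMap.id) (S₁ : Submodule ℝ W)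
    (ω : ↥S₁) : ∃ m₀ : ↥(Submodule.comap Qp S₁), (Submodule.comap Qp S₁).subtype m₀ = hP (S₁.subtype ω) := by
  have h1 : Qp (hP ω) = ω := by simpa using LinearMap.congr_fun hQpH (ω : W)
  exact ⟨⟨hP ω, by rw [Submodule.mem_comap, h1]; exact ω.2⟩, rfl⟩

omit [FiniteDimensional ℝ W] [MeasurableSpace W] [BorelSpace W] in
/-- **`Z′ = ∫dλδ(Q′λ)e^{−½‖Δλ‖²} > 0`** (in particular `≠ 0`) when `‖Δλ‖² ≥ γ‖λ‖²` on `N(Q′)` — (2.11) *"the Laplace operator Δ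
is … invertible on this subspace"* — for every additive Haar (Lebesgue) measure on `N(Q′) = {λ : Q′_jλ ∈ S₁}`.
[cite: Balaban1984PropagatorsII, (2.11) p.225, (2.95) p.240] -/
theorem Zprime_ne_zero (Qp : B →ₗ[ℝ] W) (S₁ : Submodule ℝ W) (μ' : Measure ↥(Submodule.comap Qp S₁))
    [μ'.IsAddHaarMeasure] (lap : B →ₗ[ℝ] B) (hlap : ∀ x y : B, ⟪lap x, y⟫_ℝ = ⟪x, lap y⟫_ℝ) {γ : ℝ} (hγ : 0 < γ)
    (hcoer : ∀ m : ↥(Submodule.comap Qp S₁), γ * ‖(m : B)‖ ^ 2 ≤ ‖lap m‖ ^ 2) :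
    ∫ m, Real.exp (-(1 / 2) * ‖lap ((Submodule.comap Qp S₁).subtype m)‖ ^ 2) ∂μ' ≠ 0 := by
  have h := (B6Eq226CovarianceMoments.gaussian_integrable_pos (Submodule.comap Qp S₁) μ' (lap ∘ₗ lap) hγ
    (fun k => by rw [B6Eq226CovarianceMoments.inner_lap_lap lap hlap]; exact hcoer k)).2
  simp_rw [B6Eq226CovarianceMoments.inner_lap_lap lap hlap] at h
  exact h.ne'

omit [FiniteDimensional ℝ W] [MeasurableSpace W] [BorelSpace W] in
/-- **`Z′_j = ∫dλ′δ(Q′_jλ′)e^{−½‖Δλ′‖²} > 0`** likewise, `N(Q′_j) = ker Q′_j ⊆ N(Q′)` inheriting the coercivity (2.11).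
[cite: Balaban1984PropagatorsII, (2.11) p.225, (2.95) p.240] -/
theorem ZprimeJ_ne_zero (Qp : B →ₗ[ℝ] W) (S₁ : Submodule ℝ W) (μj : Measure ↥(LinearMap.ker Qp)) [μj.IsAddHaarMeasure]
    (lap : B →ₗ[ℝ] B) (hlap : ∀ x y : B, ⟪lap x, y⟫_ℝ = ⟪x, lap y⟫_ℝ) {γ : ℝ} (hγ : 0 < γ)
    (hcoer : ∀ m : ↥(Submodule.comap Qp S₁), γ * ‖(m : B)‖ ^ 2 ≤ ‖lap m‖ ^ 2) :
    ∫ n, Real.exp (-(1 / 2) * ‖lap ((LinearMap.ker Qp).subtype n)‖ ^ 2) ∂μj ≠ 0 := by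
  have hcoer' : ∀ n : ↥(LinearMap.ker Qp), γ * ‖(n : B)‖ ^ 2 ≤ ⟪(n : B), (lap ∘ₗ lap) n⟫_ℝ := by
    intro n
    have hn : (n : B) ∈ Submodule.comap Qp S₁ := by
      rw [Submodule.mem_comap, show Qp (n : B) = 0 from n.2]; exact S₁.zero_mem
    rw [B6Eq226CovarianceMoments.inner_lap_lap lap hlap]
    exact hcoer ⟨n, hn⟩
  have h := (B6Eq226CovarianceMoments.gaussian_integrable_pos (LinearMap.ker Qp) μj (lap ∘ₗ lap) hγ hcoer').2
  simp_rw [B6Eq226CovarianceMoments.inner_lap_lap lap hlap] at h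
  exact h.ne'

omit [FiniteDimensional ℝ B] [MeasurableSpace B] [BorelSpace B] in
/-- **`Z_C = ∫dω↾_Λδ(Q′₁ω)e^{−½⟨ω,Δ′_jω⟩} > 0`** from (2.110) *"γ₀‖ω‖² ≦ ⟨ω,Δ′_jω⟩ … for ω : Q′₁ω = 0"* (coercivity of `Δ′_j` on
the admissible `ω`, a subspace `S₁`, with its Lebesgue measure). [cite: Balaban1984PropagatorsII, (2.110) p.242] -/
theorem ZC_ne_zero (S₁ : Submodule ℝ W) (ν : Measure ↥S₁) [ν.IsAddHaarMeasure] (Dp : W →ₗ[ℝ] W) {γ : ℝ} (hγ : 0 < γ)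
    (h2110 : ∀ ω : ↥S₁, γ * ‖(ω : W)‖ ^ 2 ≤ ⟪(ω : W), Dp ω⟫_ℝ) :
    ∫ ω, Real.exp (-(1 / 2) * ⟪S₁.subtype ω, Dp (S₁.subtype ω)⟫_ℝ) ∂ν ≠ 0 :=
  (B6Eq226CovarianceMoments.gaussian_integrable_pos S₁ ν Dp hγ h2110).2.ne'

omit [MeasurableSpace A] [BorelSpace A] [FiniteDimensional ℝ A] in
/-- **The remark *"∫dω′↾_Λδ(Q′₁ω′)δ(Q′_jλ′ − ω′) = δ(Q′λ′)"* for the Gaussian of (2.105)** — the hypothesis `hX` of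
`…B6Eq2112`: with Lebesgue measures on `N(Q′)`, `N(Q′_j) = ker Q′_j` and the admissible `ω`'s, there is ONE constant `cX` (a
Haar scalar factor, `…B6Eq2106.iterated_eq_smul_addHaar`) with `∫dλδ(Q′λ)e^{−½‖∂*A−Δλ‖²} = cX · ∫dω↾δ(Q′₁ω)∫dλ′δ(Q′_jλ′)
e^{−½‖∂*A−Δ(λ′+H′_jω)‖²}` for EVERY configuration `A` (Fubini; convergence from the coercivity (2.11) of `‖Δλ‖²` on `N(Q′)`).
[cite: Balaban1984PropagatorsII, (2.105)–(2.106) p.242, (2.11) p.225] -/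
theorem hX_lebesgue (Qp : B →ₗ[ℝ] W) (hP : W →ₗ[ℝ] B) (hQpH : Qp ∘ₗ hP = LinearMap.id) (S₁ : Submodule ℝ W)
    (ν : Measure ↥S₁) [ν.IsAddHaarMeasure] (μj : Measure ↥(LinearMap.ker Qp)) [μj.IsAddHaarMeasure]
    (μ' : Measure ↥(Submodule.comap Qp S₁)) [μ'.IsAddHaarMeasure]
    (lap : B →ₗ[ℝ] B) (hlap : ∀ x y : B, ⟪lap x, y⟫_ℝ = ⟪x, lap y⟫_ℝ) (dv : A →ₗ[ℝ] B) {γ : ℝ} (hγ : 0 < γ)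
    (hcoer : ∀ m : ↥(Submodule.comap Qp S₁), γ * ‖(m : B)‖ ^ 2 ≤ ‖lap m‖ ^ 2) :
    ∃ cX : ℝ, ∀ v : A, ∫ m, Real.exp (-(1 / 2) * ‖dv v - lap ((Submodule.comap Qp S₁).subtype m)‖ ^ 2) ∂μ' =
      cX * ∫ ω, ∫ n, Real.exp (-(1 / 2) *
        ‖dv v - lap ((LinearMap.ker Qp).subtype n + hP (S₁.subtype ω))‖ ^ 2) ∂μj ∂ν := by
  obtain ⟨c, hc, hmap⟩ := B6Eq2106.iterated_eq_smul_addHaar Qp hP S₁ hQpH ν μj μ'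
  have hecoe : ∀ (ω : ↥S₁) (n : ↥(LinearMap.ker Qp)),
      ((B6Eq2106.decompEquiv Qp hP S₁ hQpH (ω, n) : ↥(Submodule.comap Qp S₁)) : B) = (n : B) + hP ω :=
    B6Eq2106.decompEquiv_coe Qp hP S₁ hQpH
  generalize B6Eq2106.decompEquiv Qp hP S₁ hQpH = e at hmap hecoe
  refine ⟨((c : ℝ))⁻¹, fun v => ?_⟩
  set F : B → ℝ := fun l => Real.exp (-(1 / 2) * ‖dv v - lap l‖ ^ 2) with hF
  -- convergence of the N(Q′)-Gaussian from the coercivity (2.11)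
  have hint : Integrable (fun m : ↥(Submodule.comap Qp S₁) => F m) μ' := by
    have hcont : Continuous fun m : ↥(Submodule.comap Qp S₁) => -(1 / 2) * ‖dv v - lap (m : B)‖ ^ 2 :=
      continuous_const.mul ((continuous_const.sub
        (lap.continuous_of_finiteDimensional.comp continuous_subtype_val)).norm.pow 2)
    refine integrable_exp_of_le μ' _ hcont (γ := γ / 4) (by positivity)
      (-(1 / 2) * ‖dv v‖ ^ 2 + ‖lap (dv v)‖ ^ 2 / γ) fun m => ?_
    have h1 : ⟪dv v, lap (m : B)⟫_ℝ ≤ ‖lap (dv v)‖ * ‖(m : B)‖ := by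
      rw [← hlap]; exact real_inner_le_norm _ _
    have h2 := hcoer m
    have h3 := quad_bound hγ ‖lap (dv v)‖ ‖(m : B)‖
    rw [norm_sub_sq_real, Submodule.coe_norm]
    nlinarith [h1, h2, h3]
  -- the image measure is c • dλδ(Q′λ); integrate F against both sides
  have h1 : ∫ m, F m ∂(c • μ') = (c : ℝ) * ∫ m, F m ∂μ' := by
    rw [integral_smul_nnreal_measure, NNReal.smul_def, smul_eq_mul]
  have hcoe : ((e.toHomeomorph.toMeasurableEquiv : (↥S₁ × ↥(LinearMap.ker Qp)) ≃ᵐ ↥(Submodule.comap Qp S₁)) :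
      (↥S₁ × ↥(LinearMap.ker Qp)) → ↥(Submodule.comap Qp S₁)) = e := rfl
  have h2 : ∫ m, F m ∂((ν.prod μj).map e) = ∫ p, F (e p) ∂(ν.prod μj) := by
    rw [← hcoe]; exact integral_map_equiv e.toHomeomorph.toMeasurableEquiv (fun m : ↥(Submodule.comap Qp S₁) => F m)
  have h3 : Integrable (fun p : ↥S₁ × ↥(LinearMap.ker Qp) => F (e p)) (ν.prod μj) := by
    have h3' : Integrable (fun m : ↥(Submodule.comap Qp S₁) => F m) ((ν.prod μj).map e) := by
      rw [hmap]; exact hint.smul_measure_nnreal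
    rw [← hcoe] at h3'
    exact (integrable_map_equiv e.toHomeomorph.toMeasurableEquiv (fun m : ↥(Submodule.comap Qp S₁) => F m)).1 h3'
  have h4 : ∫ p, F (e p) ∂(ν.prod μj) = ∫ ω, ∫ n, F (e (ω, n)) ∂μj ∂ν := integral_prod _ h3
  have h5 : ∀ (ω : ↥S₁) (n : ↥(LinearMap.ker Qp)), F (e (ω, n)) =
      Real.exp (-(1 / 2) * ‖dv v - lap ((LinearMap.ker Qp).subtype n + hP (S₁.subtype ω))‖ ^ 2) := by
    intro ω n
    show Real.exp (-(1 / 2) * ‖dv v - lap ((e (ω, n) : ↥(Submodule.comap Qp S₁)) : B)‖ ^ 2) = _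
    rw [hecoe]
    rfl
  have h4' : ∫ ω, ∫ n, F (e (ω, n)) ∂μj ∂ν = ∫ ω, ∫ n, Real.exp (-(1 / 2) *
      ‖dv v - lap ((LinearMap.ker Qp).subtype n + hP (S₁.subtype ω))‖ ^ 2) ∂μj ∂ν := by
    simp_rw [h5]
  have key : (c : ℝ) * ∫ m, F m ∂μ' = ∫ ω, ∫ n, Real.exp (-(1 / 2) *
      ‖dv v - lap ((LinearMap.ker Qp).subtype n + hP (S₁.subtype ω))‖ ^ 2) ∂μj ∂ν := by
    rw [← h1, ← hmap, h2, h4, h4']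
  have hc' : (c : ℝ) ≠ 0 := by exact_mod_cast hc
  rw [← key, ← mul_assoc, inv_mul_cancel₀ hc', one_mul]
  rfl

omit [FiniteDimensional ℝ A] [MeasurableSpace A] [BorelSpace A] [FiniteDimensional ℝ B] [MeasurableSpace B]
  [BorelSpace B] in
/-- The two printed terms of (2.95)'s exponent are the form of `Δ_a`: `⟨QA,aQA⟩ + ⟨A,(Δ−∂P∂*)A⟩ = ⟨A, Δ_aA⟩` (`Q*` the
adjoint of `Q = Q″Q_j`). [cite: Balaban1984PropagatorsII, (2.19) p.226, (2.95) p.240] -/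
theorem quad_eq_deltaA (lapV : A →ₗ[ℝ] A) (grad : B →ₗ[ℝ] A) (dv : A →ₗ[ℝ] B) (P : B →ₗ[ℝ] B) (Qv : A →ₗ[ℝ] Bs)
    (Qpp : Bs →ₗ[ℝ] V) (Qs : V →ₗ[ℝ] A) (a : V →ₗ[ℝ] V) (hQ : ∀ (w : V) (v : A), ⟪Qs w, v⟫_ℝ = ⟪w, Qpp (Qv v)⟫_ℝ)
    (v : A) : ⟪Qpp (Qv v), a (Qpp (Qv v))⟫_ℝ + ⟪v, (lapV - grad ∘ₗ P ∘ₗ dv) v⟫_ℝ =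
      ⟪v, B6SectA.deltaA lapV grad dv P (Qpp ∘ₗ Qv) Qs a v⟫_ℝ := by
  have h1 : ⟪v, Qs (a (Qpp (Qv v)))⟫_ℝ = ⟪Qpp (Qv v), a (Qpp (Qv v))⟫_ℝ := by
    rw [real_inner_comm, hQ, real_inner_comm]
  simp only [B6SectA.deltaA, LinearMap.add_apply, LinearMap.sub_apply, LinearMap.comp_apply, inner_add_right,
    inner_sub_right, h1]
  ring

omit [FiniteDimensional ℝ B] [MeasurableSpace B] [BorelSpace B] in
/-- **`Z > 0` and the (2.95) Gaussian converges**, from *"the operator Δ_a is bounded from below by a positive constant"*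
(p. 226): `Z = ∫dA e^{−½⟨QA,aQA⟩−½⟨A,(Δ−∂P∂*)A⟩} ≠ 0` and the integrand of (2.95) with any source `J` is `dA`-integrable
(`…B6Eq230GaussianRoute.Z_pos`, `…B6Eq232GaussianMoment.integrable_gauss_shift` with `G = Δ_a⁻¹`) — the hypotheses `hZ`,
`hint₁` of `…B6Eq2112Assembly`. [cite: Balaban1984PropagatorsII, p.226, (2.95) p.240] -/
theorem Z_ne_zero_and_integrable (μA : Measure A) [μA.IsAddHaarMeasure] (lapV : A →ₗ[ℝ] A) (grad : B →ₗ[ℝ] A)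
    (dv : A →ₗ[ℝ] B) (K : Submodule ℝ B) [K.HasOrthogonalProjection] (P : B →ₗ[ℝ] B)
    (hPK : ∀ g, P g = g - K.starProjection g) (Qv : A →ₗ[ℝ] Bs) (Qpp : Bs →ₗ[ℝ] V) (Qs : V →ₗ[ℝ] A) (a : V →ₗ[ℝ] V)
    (hlapVsym : ∀ x y : A, ⟪lapV x, y⟫_ℝ = ⟪x, lapV y⟫_ℝ) (hgrad : ∀ (b : B) (x : A), ⟪grad b, x⟫_ℝ = ⟪b, dv x⟫_ℝ)
    (hQ : ∀ (w : V) (v : A), ⟪Qs w, v⟫_ℝ = ⟪w, Qpp (Qv v)⟫_ℝ) (ha : ∀ x y : V, ⟪a x, y⟫_ℝ = ⟪x, a y⟫_ℝ)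
    (G : A →ₗ[ℝ] A) (hG : B6SectA.deltaA lapV grad dv P (Qpp ∘ₗ Qv) Qs a ∘ₗ G = LinearMap.id) {γ : ℝ} (hγ : 0 < γ)
    (hΔa : ∀ v : A, γ * ‖v‖ ^ 2 ≤ ⟪v, B6SectA.deltaA lapV grad dv P (Qpp ∘ₗ Qv) Qs a v⟫_ℝ) :
    (∫ v, Real.exp (-(1 / 2) * ⟪Qpp (Qv v), a (Qpp (Qv v))⟫_ℝ - (1 / 2) * ⟪v, (lapV - grad ∘ₗ P ∘ₗ dv) v⟫_ℝ) ∂μA ≠ 0) ∧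
      ∀ J : A, Integrable (fun v : A => Real.exp (-(1 / 2) * ⟪Qpp (Qv v), a (Qpp (Qv v))⟫_ℝ
        - (1 / 2) * ⟪v, (lapV - grad ∘ₗ P ∘ₗ dv) v⟫_ℝ + ⟪v, J⟫_ℝ)) μA := by
  have hZ := B6Eq230GaussianRoute.Z_pos μA (B6SectA.deltaA lapV grad dv P (Qpp ∘ₗ Qv) Qs a) hγ hΔa
  have hexp : ∀ v : A, -(1 / 2) * ⟪Qpp (Qv v), a (Qpp (Qv v))⟫_ℝ - (1 / 2) * ⟪v, (lapV - grad ∘ₗ P ∘ₗ dv) v⟫_ℝ =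
      -(1 / 2) * ⟪v, B6SectA.deltaA lapV grad dv P (Qpp ∘ₗ Qv) Qs a v⟫_ℝ := fun v => by
    rw [← quad_eq_deltaA lapV grad dv P Qv Qpp Qs a hQ v]; ring
  refine ⟨?_, fun J => ?_⟩
  · simp_rw [hexp]; exact hZ.2.ne'
  · have h := B6Eq232GaussianMoment.integrable_gauss_shift μA _ G
      (B6Eq2112Assembly.deltaA_symm K P hPK lapV grad dv (Qpp ∘ₗ Qv) Qs a hlapVsym hgrad hQ ha) hG hZ.1 J
    simp_rw [hexp]; exact h

omit [FiniteDimensional ℝ A] [MeasurableSpace A] [BorelSpace A] [FiniteDimensional ℝ B] [MeasurableSpace B]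
  [BorelSpace B] in
/-- **The (2.112) integrand converges over the gauge-fixed configurations** when its quadratic form
`⟨Q″Q_jA′,aQ″Q_jA′⟩ + ⟨A′,(Δ−∂P_j∂*)A′⟩` is positive definite there (p. 244 *"It is a Gaussian integral defined by the
quadratic form (2.120)"*, p. 246 *"the forms are bounded from below by γ₀″‖B‖²"*) — the hypothesis `hint₂` of
`…B6Eq2112Assembly`, for every source `J′`. [cite: Balaban1984PropagatorsII, (2.112) p.243, (2.120) p.244, p.246] -/
theorem integrable_2112 (μS : Measure S) [μS.IsAddHaarMeasure] (σ : S →ₗ[ℝ] A) (lapV : A →ₗ[ℝ] A) (grad : B →ₗ[ℝ] A)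
    (dv : A →ₗ[ℝ] B) (Pj : B →ₗ[ℝ] B) (Qv : A →ₗ[ℝ] Bs) (Qpp : Bs →ₗ[ℝ] V) (a : V →ₗ[ℝ] V) {γ : ℝ} (hγ : 0 < γ)
    (hpos : ∀ s : S, γ * ‖s‖ ^ 2 ≤
      ⟪Qpp (Qv (σ s)), a (Qpp (Qv (σ s)))⟫_ℝ + ⟪σ s, (lapV - grad ∘ₗ Pj ∘ₗ dv) (σ s)⟫_ℝ) (J' : A) :
    Integrable (fun s : S => Real.exp (-(1 / 2) * ⟪Qpp (Qv (σ s)), a (Qpp (Qv (σ s)))⟫_ℝ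
      - (1 / 2) * ⟪σ s, (lapV - grad ∘ₗ Pj ∘ₗ dv) (σ s)⟫_ℝ + ⟪σ s, J'⟫_ℝ)) μS := by
  set σL := LinearMap.toContinuousLinearMap σ with hσL
  have hσ : Continuous σ := σ.continuous_of_finiteDimensional
  have hcont : Continuous fun s : S => -(1 / 2) * ⟪Qpp (Qv (σ s)), a (Qpp (Qv (σ s)))⟫_ℝ
      - (1 / 2) * ⟪σ s, (lapV - grad ∘ₗ Pj ∘ₗ dv) (σ s)⟫_ℝ + ⟪σ s, J'⟫_ℝ := by
    have h1 : Continuous fun s : S => Qpp (Qv (σ s)) := (Qpp ∘ₗ Qv ∘ₗ σ).continuous_of_finiteDimensional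
    have h2 : Continuous fun s : S => a (Qpp (Qv (σ s))) := (a ∘ₗ Qpp ∘ₗ Qv ∘ₗ σ).continuous_of_finiteDimensional
    have h3 : Continuous fun s : S => (lapV - grad ∘ₗ Pj ∘ₗ dv) (σ s) :=
      ((lapV - grad ∘ₗ Pj ∘ₗ dv) ∘ₗ σ).continuous_of_finiteDimensional
    have h4 : Continuous fun s : S => ⟪Qpp (Qv (σ s)), a (Qpp (Qv (σ s)))⟫_ℝ := Continuous.inner (𝕜 := ℝ) h1 h2
    have h5 : Continuous fun s : S => ⟪σ s, (lapV - grad ∘ₗ Pj ∘ₗ dv) (σ s)⟫_ℝ := Continuous.inner (𝕜 := ℝ) hσ h3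
    have h6 : Continuous fun s : S => ⟪σ s, J'⟫_ℝ := Continuous.inner (𝕜 := ℝ) hσ continuous_const
    exact ((continuous_const.mul h4).sub (continuous_const.mul h5)).add h6
  refine integrable_exp_of_le μS _ hcont (γ := γ / 4) (by positivity) ((‖σL‖ * ‖J'‖) ^ 2 / γ) fun s => ?_
  have h1 : ⟪σ s, J'⟫_ℝ ≤ (‖σL‖ * ‖J'‖) * ‖s‖ := by
    calc ⟪σ s, J'⟫_ℝ ≤ ‖σ s‖ * ‖J'‖ := real_inner_le_norm _ _
      _ ≤ (‖σL‖ * ‖s‖) * ‖J'‖ := by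
          gcongr
          rw [show σ s = σL s by simp [hσL]]
          exact σL.le_opNorm s
      _ = (‖σL‖ * ‖J'‖) * ‖s‖ := by ring
  have h2 := hpos s
  have h3 := quad_bound hγ (‖σL‖ * ‖J'‖) ‖s‖
  nlinarith [h1, h2, h3]


/-! ## §3  (2.129) from (2.95) in the Lebesgue model: positivity in, analysis out -/

/-- **(2.129) p. 246 from (2.95) p. 240, Lebesgue model.**  `…B6Eq2112Assembly.eq2129_of_295` with EVERY analytic hypothesis
discharged: `N(Q′_j) = ker Q′_j`, the admissible `ω`'s = `S₁ ≤ W`, `N(Q′) = {λ : Q′_jλ ∈ S₁}` with additive Haar (Lebesgue)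
measures `μj`, `ν`, `μ'`; the convergence of the (2.95)/(2.112) Gaussians, `Z, Z′, Z′_j, Z_C ≠ 0` and the remark on `δ(Q′λ)`
follow from the printed POSITIVITY statements, which are the analytic hypotheses left: `Δ_a ≥ γ_a > 0` (p. 226 *"the operator
Δ_a is bounded from below by a positive constant"*, `hΔa`), `‖Δλ‖² ≥ γ_Q‖λ‖²` on `N(Q′)` ((2.11), `hcoerQ`), (2.110)
`⟨ω,Δ′_jω⟩ ≥ γ_C‖ω‖²` on the admissible `ω` (`h2110`), and positivity `γ₂` of the (2.112)/(2.120) form on the gauge-fixed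
configurations (`hpos₂`, p. 246).  Structural data as in `…B6Eq2112Assembly` ((2.96) = `e₁`, `dA′ = dB·dA↾{Q_jA = B}` = `e₂`,
adjoints, (2.98) `horth`, (2.103) `h2103`, (2.104) `h2104`, `G = Δ_a⁻¹` (`hG`), the covariances `C^{(j)}_Λ`, `G̃_j`, `C̃^{(j)}_Λ`,
(2.116)–(2.118) `h2118`).  Conclusion AS PRINTED: *"⟨J,GJ⟩ = ⟨J,∂H′_jC^{(j)}_ΛH′_j*∂*J⟩ + ⟨J − ∂ΔH′_jC^{(j)}_ΛH′_j*∂*J,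
(G̃_j + H_jC̃^{(j)}_ΛH_j*)(J − ∂ΔH′_jC^{(j)}_ΛH′_j*∂*J)⟩. (2.129)"* [cite: Balaban1984PropagatorsII, (2.95) p.240, (2.112) p.243, (2.129) p.246] -/
theorem eq2129_lebesgue
    (μA : Measure A) [μA.IsAddHaarMeasure] (μS : Measure S) [μS.IsAddHaarMeasure] (νB : Measure NB) [νB.IsAddHaarMeasure]
    (μN : Measure N) [μN.IsAddHaarMeasure] (Qp : B →ₗ[ℝ] W) (S₁ : Submodule ℝ W) (ν : Measure ↥S₁) [ν.IsAddHaarMeasure]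
    (μj : Measure ↥(LinearMap.ker Qp)) [μj.IsAddHaarMeasure] (μ' : Measure ↥(Submodule.comap Qp S₁)) [μ'.IsAddHaarMeasure]
    (lap : B →ₗ[ℝ] B) (hlap : ∀ x y : B, ⟪lap x, y⟫_ℝ = ⟪x, lap y⟫_ℝ)
    (K : Submodule ℝ B) [K.HasOrthogonalProjection] (hK : LinearMap.range (lap ∘ₗ (Submodule.comap Qp S₁).subtype) = K)
    (P : B →ₗ[ℝ] B) (hPK : ∀ g, P g = g - K.starProjection g)
    (Kj : Submodule ℝ B) [Kj.HasOrthogonalProjection] (hKj : LinearMap.range (lap ∘ₗ (LinearMap.ker Qp).subtype) = Kj)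
    (Rj Pj : B →ₗ[ℝ] B) (hRj : ∀ g, Rj g = Kj.starProjection g) (hPj : ∀ g, Pj g = g - Kj.starProjection g)
    (lapV : A →ₗ[ℝ] A) (curl : A →ₗ[ℝ] T) (grad : B →ₗ[ℝ] A) (dv : A →ₗ[ℝ] B)
    (hlapVsym : ∀ x y : A, ⟪lapV x, y⟫_ℝ = ⟪x, lapV y⟫_ℝ)
    (hlapV : ∀ v : A, ⟪v, lapV v⟫_ℝ = ‖curl v‖ ^ 2 + ‖dv v‖ ^ 2)
    (hgrad : ∀ (b : B) (x : A), ⟪grad b, x⟫_ℝ = ⟪b, dv x⟫_ℝ) (hΔ : ∀ b : B, dv (grad b) = lap b)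
    (hcurl : ∀ b : B, curl (grad b) = 0)
    (Qv : A →ₗ[ℝ] Bs) (Qpp : Bs →ₗ[ℝ] V) (Qs : V →ₗ[ℝ] A) (a : V →ₗ[ℝ] V)
    (hQ : ∀ (w : V) (v : A), ⟪Qs w, v⟫_ℝ = ⟪w, Qpp (Qv v)⟫_ℝ) (ha : ∀ x y : V, ⟪a x, y⟫_ℝ = ⟪x, a y⟫_ℝ)
    (G : A →ₗ[ℝ] A) (hG : B6SectA.deltaA lapV grad dv P (Qpp ∘ₗ Qv) Qs a ∘ₗ G = LinearMap.id)
    (hP : W →ₗ[ℝ] B) (hPs : B →ₗ[ℝ] W) (hH : ∀ (w : W) (b : B), ⟪hP w, b⟫_ℝ = ⟪w, hPs b⟫_ℝ)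
    (hQpH : Qp ∘ₗ hP = LinearMap.id) (d1 : W →ₗ[ℝ] Bs)
    (h2103 : ∀ b : B, Qv (grad b) = d1 (Qp b)) (h2104 : ∀ ω : ↥S₁, Qpp (d1 (S₁.subtype ω)) = 0)
    (horth : ∀ (n : ↥(LinearMap.ker Qp)) (w : W), ⟪lap ((LinearMap.ker Qp).subtype n), lap (hP w)⟫_ℝ = 0)
    (C : W →ₗ[ℝ] W) (TC : W →ₗ[ℝ] ↥S₁) (hC : ∀ x y : W, ⟪C x, y⟫_ℝ = ⟪x, C y⟫_ℝ) (hCr : ∀ s, C s = S₁.subtype (TC s))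
    (hCsol : ∀ (ω : ↥S₁) (s : W), ⟪S₁.subtype ω, (hPs ∘ₗ lap ∘ₗ lap ∘ₗ hP) (C s)⟫_ℝ = ⟪S₁.subtype ω, s⟫_ℝ)
    (σ : S →ₗ[ℝ] A) (e₁ : (↥S₁ × S) ≃L[ℝ] A) (he₁ : ∀ (ω : ↥S₁) (s : S), e₁ (ω, s) = σ s - grad (hP (S₁.subtype ω)))
    (ιB : NB →ₗ[ℝ] Bs) (ιA : N →ₗ[ℝ] A) (Hj : Bs →ₗ[ℝ] A) (hιA : ∀ n, Qv (ιA n) = 0) (hHj : ∀ b, Qv (Hj b) = b)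
    (e₂ : (NB × N) ≃L[ℝ] S) (he₂ : ∀ (m : NB) (n : N), σ (e₂ (m, n)) = ιA n + Hj (ιB m))
    (Gt : A →ₗ[ℝ] A) (Tt : A →ₗ[ℝ] N) (hGt : ∀ J', Gt J' = ιA (Tt J'))
    (hsol : ∀ (n : N) (J' : A), ⟪ιA n, (lapV - grad ∘ₗ Pj ∘ₗ dv) (Gt J')⟫_ℝ = ⟪ιA n, J'⟫_ℝ)
    (hcrit : ∀ (b : Bs) (v : A), Qv v = 0 → ⟪v, (lapV - grad ∘ₗ Pj ∘ₗ dv) (Hj b)⟫_ℝ = 0)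
    (Hjs : A →ₗ[ℝ] Bs) (hadj : ∀ (b : Bs) (x : A), ⟪Hj b, x⟫_ℝ = ⟪b, Hjs x⟫_ℝ) (Δj : Bs →ₗ[ℝ] Bs)
    (h2118 : ∀ b : Bs, ⟪Hj b, (lapV - grad ∘ₗ Pj ∘ₗ dv) (Hj b)⟫_ℝ = ⟪b, Δj b⟫_ℝ)
    (TB : Bs →ₗ[ℝ] NB) (Qpps : V →ₗ[ℝ] Bs) (Ct : Bs →ₗ[ℝ] Bs)
    (hQpp : ∀ (w : V) (b : Bs), ⟪Qpps w, b⟫_ℝ = ⟪w, Qpp b⟫_ℝ) (hΔj : ∀ x y : Bs, ⟪Δj x, y⟫_ℝ = ⟪x, Δj y⟫_ℝ)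
    (hCt : ∀ K', Ct K' = ιB (TB K'))
    (hCtsol : ∀ (m : NB) (K' : Bs), ⟪ιB m, (Qpps ∘ₗ a ∘ₗ Qpp + Δj) (Ct K')⟫_ℝ = ⟪ιB m, K'⟫_ℝ)
    -- the four printed positivity statements
    {γa : ℝ} (hγa : 0 < γa) (hΔa : ∀ v : A, γa * ‖v‖ ^ 2 ≤ ⟪v, B6SectA.deltaA lapV grad dv P (Qpp ∘ₗ Qv) Qs a v⟫_ℝ)
    {γQ : ℝ} (hγQ : 0 < γQ) (hcoerQ : ∀ m : ↥(Submodule.comap Qp S₁), γQ * ‖(m : B)‖ ^ 2 ≤ ‖lap m‖ ^ 2)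
    {γC : ℝ} (hγC : 0 < γC) (h2110 : ∀ ω : ↥S₁, γC * ‖(ω : W)‖ ^ 2 ≤ ⟪(ω : W), (hPs ∘ₗ lap ∘ₗ lap ∘ₗ hP) ω⟫_ℝ)
    {γ₂ : ℝ} (hγ₂ : 0 < γ₂) (hpos₂ : ∀ s : S, γ₂ * ‖s‖ ^ 2 ≤
      ⟪Qpp (Qv (σ s)), a (Qpp (Qv (σ s)))⟫_ℝ + ⟪σ s, (lapV - grad ∘ₗ Pj ∘ₗ dv) (σ s)⟫_ℝ) (J : A) :
    ⟪J, G J⟫_ℝ = ⟪J, (grad ∘ₗ hP ∘ₗ C ∘ₗ hPs ∘ₗ dv) J⟫_ℝ +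
      ⟪J - (grad ∘ₗ lap ∘ₗ hP ∘ₗ C ∘ₗ hPs ∘ₗ dv) J,
        (Gt + Hj ∘ₗ Ct ∘ₗ Hjs) (J - (grad ∘ₗ lap ∘ₗ hP ∘ₗ C ∘ₗ hPs ∘ₗ dv) J)⟫_ℝ := by
  obtain ⟨cX, hX⟩ := hX_lebesgue Qp hP hQpH S₁ ν μj μ' lap hlap dv hγQ hcoerQ
  have hZI := Z_ne_zero_and_integrable μA lapV grad dv K P hPK Qv Qpp Qs a hlapVsym hgrad hQ ha G hG hγa hΔa
  exact B6Eq2112Assembly.eq2129_of_295 μA ν μS νB μN μj μ' lap hlap (Submodule.comap Qp S₁).subtype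
    (LinearMap.ker Qp).subtype K hK P hPK Kj hKj Rj Pj hRj hPj lapV curl grad dv hlapVsym hlapV hgrad hΔ hcurl Qv Qpp Qs
    a hQ ha G hG hP hPs hH S₁.subtype Qp hQpH d1 h2103 h2104 horth (mem_comap_hP Qp hP hQpH S₁) C TC hC hCr hCsol
    (ZC_ne_zero S₁ ν (hPs ∘ₗ lap ∘ₗ lap ∘ₗ hP) hγC h2110) cX hX (Zprime_ne_zero Qp S₁ μ' lap hlap hγQ hcoerQ)
    (ZprimeJ_ne_zero Qp S₁ μj lap hlap hγQ hcoerQ) σ e₁ he₁ ιB ιA Hj hιA hHj e₂ he₂ (fun J' => hZI.2 J')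
    (fun J' => integrable_2112 μS σ lapV grad dv Pj Qv Qpp a hγ₂ hpos₂ _) hZI.1 Gt Tt hGt hsol hcrit Hjs hadj Δj
    h2118 TB Qpps Ct hQpp hΔj hCt hCtsol J

end Lebesgue

end Literature.MathematicalPhysics.QuantumFieldTheory.Balaban1983to89.B6Eq2112Lebesgue

end
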